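import Summits.BirchSwinnertonDyer.BirchSwinnertonDyer.Theorems.ClassRecordThreeEulerHalvesAtThreeResidualUpperBoundCartanEmptyDegreeIndepConj
import Summits.BirchSwinnertonDyer.BirchSwinnertonDyer.Theorems.ClassRecordThreeEulerHalvesAtThreeResidualUpperBoundCartanEmptyDegreeIndepTransport
import Summits.BirchSwinnertonDyer.BirchSwinnertonDyer.Theorems.ClassRecordThreeEulerHalvesAtThreeCartanDegreeDefs
import HarnessLib

/-!
# Crux 23422 `EulerHalvesAtThreeResidualUpperBound`, line `cartan`, stub (F2⁰) `CartanDegree.CartanEmptyDegreeIndep`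
# FROM EICHLER'S PRINCIPAL-IDEAL THEOREM: units of norm `-1`, type number one, the conjugator, the assembly

Seat `bsd-stepL-cartan-f20` (AUTOFILL #2 row (2); `--supports stmt-BirchSwinnertonDyer-23422`). Main results:

* `exists_units_reducedNorm_eq_neg_one` — a unit of reduced norm `-1` in the Eichler order of `X₀^D(M)`, `D > 1`
  (`n(O^×) = {±1}`), from Eichler's theorem applied to a principal ideal of negative norm;
* `exists_units_conj_eq_of_isEichlerOrder` — TYPE NUMBER ONE: every Eichler order of level `M` of `X.B` (`D > 1`) is
  `β X.O β⁻¹` (connecting ideal, tree `IsEichlerOrder.exists_isInvertibleRightIdeal_leftOrderOf_eq`, made integral and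
  principal by Eichler's theorem; `O_ℓ(β O) = β O β⁻¹`);
* `exists_gl_pos_conj` — two Eichler presentations `(B, O, ι)` of `X₀^D(M)` are `GL₂⁺(ℝ)`-conjugate (Hasse–Brauer–Noether:
  tree `nonempty_algEquiv_of_ramifiedPlaces_eq_holds`; type number one; Skolem–Noether; sign fixed by a norm-`-1` unit);
* `cartanEmptyDegreeIndep_of_eichler` — **(F2⁰) `CartanDegree.CartanEmptyDegreeIndep` under the single hypothesis `hE`**,
  the VERBATIM statement of the tree theorem `ShimuraCurveData.exists_eq_units_smul_of_pos`
  (`Literature/NumberTheory/Automorphic/ShimuraCurveIdealsPrincipal.lean`, Vignéras III §5 Cor. 5.7: invertible integral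
  right ideals of the Eichler order of `X₀^D(M)`, `D > 1`, are principal with a generator of positive norm).

WHY A HYPOTHESIS AND NOT AN IMPORT: at the time of writing the hub holds no olean for `ShimuraCurveIdealsPrincipal` (nor for
24 modules of its import closure, all accepted 2026-08-15/16), so a file importing it cannot be elaborated or gate-verified
(`lean check` rc 75 `remote:stale:…:unbuilt`); an operator `ledger build` request is filed. The unconditional stub is then the
one-liner `cartanEmptyDegreeIndep_of_eichler (fun X hD hM _ hI hIO => X.exists_eq_units_smul_of_pos hD hM hI hIO)`
(file `…CartanEmptyDegreeIndep.lean`, submitted as soon as the olean exists). `hE` is used only for `D > 1`; the `D = 1` case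
and the whole analytic transport are unconditional.

HONEST FRAMING: closes no statement item by itself (helper, conditional on a tree theorem's statement); nothing about `Ш`;
BSD is proved for no curve. References: [cite: VignerasLNM800, Ch. III §5 Cor. 5.7 and remark after Cor. 5.5 (Eichler orders of
the same level are connected), Ch. III §3 Thm. 3.1, Ch. I §2 Thm. 2.1, Ch. I §4 Lemme 4.12]
[cite: KohenPacetti2016, Rem. 3.8 (arXiv:1403.7801v3 p. 15)] [cite: PastenShimura2024, §2 p. 12 (δ_{D,M}) and Prop. 5.1].
-/

set_option linter.dupNamespace false
set_option autoImplicit false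

noncomputable section

open scoped MatrixGroups Pointwise

namespace Summit.BirchSwinnertonDyer.BirchSwinnertonDyer.Theorems.CartanDegree

open Literature.NumberTheory.Automorphic NumberField IsDedekindDomain

/-! ## §4 (continued) Units of norm `-1` and type number one for `X₀^D(M)`, `D > 1`, from Eichler's theorem -/

section OneLt

variable {D M : ℕ} (X : ShimuraCurveData D M)

/-- **A unit of reduced norm `-1` in the Eichler order of `X₀^D(M)`, `D > 1`** — from Eichler's principal-ideal theorem
with POSITIVE generators (hypothesis `hE`; the tree theorem `ShimuraCurveData.exists_eq_units_smul_of_pos`, Vignéras III §5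
Cor. 5.7): for `β₀ ∈ O` of negative norm the principal ideal `β₀ O` is `β O` with `nrd β > 0`, and `u = β⁻¹ β₀ ∈ O^×` has
`nrd u = nrd β₀ / nrd β < 0`, hence `= -1` (Vignéras I §4 Lemme 4.12: units of an order have norm `±1`). This is
`n(O^×) = ℤ^× = {±1}` for Eichler orders of indefinite quaternion algebras over `ℚ`. [cite: VignerasLNM800, Ch. III §5 Cor. 5.7 and Ch. I §4 Lemme 4.12] -/
theorem exists_units_reducedNorm_eq_neg_one (hD : 1 < D)
    (hE : ∀ {I : Submodule ℤ X.B}, IsInvertibleRightIdeal X.O I → I ≤ X.O →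
      ∃ β : (X.B)ˣ, (β : X.B) ∈ X.O ∧ 0 < reducedNorm ℚ X.B β ∧ I = β • X.O) :
    ∃ u : (X.B)ˣ, (u : X.B) ∈ X.O ∧ ((u⁻¹ : (X.B)ˣ) : X.B) ∈ X.O ∧ reducedNorm ℚ X.B u = -1 := by
  have hdiv : ∀ x : X.B, x ≠ 0 → IsUnit x := fun x hx => (isUnit_iff_ne_zero_of_one_lt X hD x).mpr hx
  obtain ⟨x₀, hx₀⟩ := exists_reducedNorm_neg_of_algHom_real X.ι
  obtain ⟨n, hn0, hnx⟩ := X.isOrder.isFullLattice.2 x₀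
  have hnrd : reducedNorm ℚ X.B (n • x₀) < 0 := by
    rw [reducedNorm_zsmul]
    exact mul_neg_of_pos_of_neg (by positivity) hx₀
  have hβ₀0 : n • x₀ ≠ 0 := by
    intro h
    rw [h, ← zero_smul ℚ (0 : X.B), reducedNorm_smul, zero_pow two_ne_zero, zero_mul] at hnrd
    exact lt_irrefl _ hnrd
  set b₀ : (X.B)ˣ := (hdiv _ hβ₀0).unit with hb₀
  have hb₀v : (b₀ : X.B) = n • x₀ := (hdiv _ hβ₀0).unit_spec
  -- the principal ideal `β₀ O`
  have hI : IsInvertibleRightIdeal X.O (b₀ • X.O) := X.isZOrder.isInvertibleRightIdeal_self.units_smul b₀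
  have hIO : b₀ • X.O ≤ X.O := by
    intro y hy
    rw [mem_units_smul_submodule_iff] at hy
    have : y = (b₀ : X.B) * ((b₀⁻¹ : (X.B)ˣ) • y) := by
      rw [Units.smul_def, smul_eq_mul, Units.mul_inv_cancel_left]
    rw [this, hb₀v]
    exact X.isOrder.mul_mem _ hnx _ hy
  obtain ⟨β, hβO, hβpos, hIβ⟩ := hE hI hIO
  refine ⟨β⁻¹ * b₀, ?_, ?_, ?_⟩
  · -- `β⁻¹ β₀ ∈ O` since `β₀ ∈ β₀ O = β O`
    have h1 : (b₀ : X.B) ∈ β • X.O := by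
      rw [← hIβ, mem_units_smul_submodule_iff, Units.smul_def, smul_eq_mul, Units.inv_mul]
      exact X.isOrder.one_mem
    rw [mem_units_smul_submodule_iff, Units.smul_def, smul_eq_mul] at h1
    simpa only [Units.val_mul] using h1
  · -- `β₀⁻¹ β ∈ O` since `β ∈ β O = β₀ O`
    have h1 : (β : X.B) ∈ b₀ • X.O := by
      rw [hIβ, mem_units_smul_submodule_iff, Units.smul_def, smul_eq_mul, Units.inv_mul]
      exact X.isOrder.one_mem
    rw [mem_units_smul_submodule_iff, Units.smul_def, smul_eq_mul] at h1
    simpa only [mul_inv_rev, inv_inv, Units.val_mul] using h1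
  · -- the norm is negative, and `±1`
    have hneg : reducedNorm ℚ X.B ((β⁻¹ * b₀ : (X.B)ˣ) : X.B) < 0 := by
      rw [Units.val_mul, reducedNorm_mul_holds ℚ X.B, reducedNorm_units_inv, hb₀v]
      exact mul_neg_of_pos_of_neg (inv_pos.mpr hβpos) hnrd
    have hmemO : ((β⁻¹ * b₀ : (X.B)ˣ) : X.B) ∈ X.O := by
      have h1 : (b₀ : X.B) ∈ β • X.O := by
        rw [← hIβ, mem_units_smul_submodule_iff, Units.smul_def, smul_eq_mul, Units.inv_mul]
        exact X.isOrder.one_mem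
      rw [mem_units_smul_submodule_iff, Units.smul_def, smul_eq_mul] at h1
      simpa only [Units.val_mul] using h1
    have hinvO : (((β⁻¹ * b₀)⁻¹ : (X.B)ˣ) : X.B) ∈ X.O := by
      have h1 : (β : X.B) ∈ b₀ • X.O := by
        rw [hIβ, mem_units_smul_submodule_iff, Units.smul_def, smul_eq_mul, Units.inv_mul]
        exact X.isOrder.one_mem
      rw [mem_units_smul_submodule_iff, Units.smul_def, smul_eq_mul] at h1
      simpa only [mul_inv_rev, inv_inv, Units.val_mul] using h1
    have hpm := (X.isOrder.exists_inv_mem_iff hmemO).mp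
      ⟨_, hinvO, by rw [Units.mul_inv], by rw [Units.inv_mul]⟩
    rcases hpm with h | h
    · rw [h] at hneg; norm_num at hneg
    · exact h

/-- A central unit acts trivially by conjugation on lattices: `c (S c⁻¹)… = S` for `c = n ∈ ℚ^×`. [folklore] -/
theorem units_smul_op_smul_eq_of_algebraMap (q : ℚˣ) (S : Submodule ℤ X.B) :
    (Units.map (algebraMap ℚ X.B : ℚ →* X.B) q) •
      (MulOpposite.op (((Units.map (algebraMap ℚ X.B : ℚ →* X.B) q)⁻¹ : (X.B)ˣ) : X.B) • S) = S := by
  ext x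
  rw [mem_units_smul_submodule_iff, mem_op_units_smul_submodule_iff, inv_inv, Units.smul_def, smul_eq_mul,
    ← map_inv, Units.coe_map, Units.coe_map, MonoidHom.coe_coe, mul_assoc, ← Algebra.commutes, ← mul_assoc,
    ← map_mul, Units.inv_mul, map_one, one_mul]

/-- **Type number one for `X₀^D(M)`, `D > 1`** — every Eichler order `O'` of level `M` in `X.B` is a conjugate
`β O β⁻¹` of `X.O`: `O` and `O'` are connected by an invertible right `O`-ideal `I` with `O_ℓ(I) = O'` (tree
`IsEichlerOrder.exists_isInvertibleRightIdeal_leftOrderOf_eq`, Vignéras III §5 after Cor. 5.5), an integral multiple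
`n I ⊆ O` is principal `β O` by Eichler's theorem (hypothesis `hE` = tree `ShimuraCurveData.exists_eq_units_smul_of_pos`,
III §5 Cor. 5.7), and `O_ℓ(β O) = β O β⁻¹`. [cite: VignerasLNM800, Ch. III §5 Cor. 5.7 and remark after Cor. 5.5] -/
theorem exists_units_conj_eq_of_isEichlerOrder (hD : 1 < D)
    (hE : ∀ {I : Submodule ℤ X.B}, IsInvertibleRightIdeal X.O I → I ≤ X.O →
      ∃ β : (X.B)ˣ, (β : X.B) ∈ X.O ∧ 0 < reducedNorm ℚ X.B β ∧ I = β • X.O)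
    {O' : Submodule ℤ X.B} (hO' : Brandt.IsEichlerOrder X.B O' M) :
    ∃ β : (X.B)ˣ, O' = β • (MulOpposite.op ((β⁻¹ : (X.B)ˣ) : X.B) • X.O) := by
  have hM : M ≠ 0 := by
    haveI : IsAddTorsionFree X.B := isAddTorsionFree_of_charZero_module ℚ X.B
    obtain ⟨O₁, O₂, h₁, -, -, hidx⟩ := X.isEichlerOrder
    rw [← hidx]
    exact relIndex_ne_zero_of_isFullLattice X.isOrder.isFullLattice h₁.1.isFullLattice.1
  have hdiv : ∀ x : X.B, x ≠ 0 → IsUnit x := fun x hx => (isUnit_iff_ne_zero_of_one_lt X hD x).mpr hx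
  have hOZ : IsEichlerOrder X.O M := isEichlerOrder_iff_brandt.mpr X.isEichlerOrder
  have hO'Z : IsEichlerOrder O' M := isEichlerOrder_iff_brandt.mpr hO'
  obtain ⟨I, hI, hIℓ⟩ := hOZ.exists_isInvertibleRightIdeal_leftOrderOf_eq hdiv hO'Z hM
  obtain ⟨n, hn0, hn⟩ := exists_smul_mem_of_fg X.isOrder.isFullLattice hI.isFullLattice.1
  have hnQ : (n : ℚ) ≠ 0 := by exact_mod_cast hn0
  set nu : (X.B)ˣ := Units.map (algebraMap ℚ X.B : ℚ →* X.B) (Units.mk0 (n : ℚ) hnQ) with hnu_def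
  have hnu : (nu : X.B) = algebraMap ℚ X.B (n : ℚ) := rfl
  have hJ : IsInvertibleRightIdeal X.O (nu • I) := hI.units_smul nu
  have hJO : nu • I ≤ X.O := by
    intro y hy
    rw [mem_units_smul_submodule_iff] at hy
    have h := hn _ hy
    rwa [← Int.cast_smul_eq_zsmul ℚ, Algebra.smul_def, ← hnu, Units.smul_def, smul_eq_mul,
      Units.mul_inv_cancel_left] at h
  obtain ⟨β, -, -, hJβ⟩ := hE hJ hJO
  refine ⟨β, ?_⟩
  calc O' = leftOrderOf I := hIℓ.symm
    _ = leftOrderOf (nu • I) := by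
        rw [leftOrderOf_units_smul, hnu_def, units_smul_op_smul_eq_of_algebraMap]
    _ = leftOrderOf (β • X.O) := by rw [hJβ]
    _ = β • (MulOpposite.op ((β⁻¹ : (X.B)ˣ) : X.B) • leftOrderOf X.O) := leftOrderOf_units_smul β X.O
    _ = β • (MulOpposite.op ((β⁻¹ : (X.B)ˣ) : X.B) • X.O) := by rw [X.isZOrder.leftOrderOf_eq]

end OneLt

/-! ## §5 The conjugation datum for two Eichler presentations of `X₀^D(M)` -/

/-- **Two Eichler presentations `(B, O, ι)` of `X₀^D(M)` are `GL₂⁺(ℝ)`-conjugate** — for `X₁, X₂ : ShimuraCurveData D M`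
there is `g ∈ GL₂(ℝ)` with `det g > 0` and `ι₂(O₂) = g ι₁(O₁) g⁻¹` (elementwise: a real matrix `m` is `ι₁(x)`, `x ∈ O₁`,
iff `g m g⁻¹` is `ι₂(y)`, `y ∈ O₂`). `D = 1`: both are conjugates of `{A ∈ M₂(ℤ) : M ∣ A₁₀}` (§3). `D > 1`: the algebras
are isomorphic (same ramification, Hasse–Brauer–Noether: tree `nonempty_algEquiv_of_ramifiedPlaces_eq_holds`,
Vignéras III Thm. 3.1), the two Eichler orders of level `M` are conjugate (type number one, §4, from the hypothesis
`hE` = Eichler's principal-ideal theorem = tree `ShimuraCurveData.exists_eq_units_smul_of_pos`), the two real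
splittings differ by an inner automorphism (Skolem–Noether, §1), and the sign of `det g` is adjusted by a unit of
norm `-1` of `O₁` (§4). [cite: VignerasLNM800, Ch. III §3 Thm. 3.1, §5 Cor. 5.7, Ch. I §2 Thm. 2.1] -/
theorem exists_gl_pos_conj {D M : ℕ} (X₁ X₂ : ShimuraCurveData D M)
    (hE : 1 < D → ∀ (X : ShimuraCurveData D M) {I : Submodule ℤ X.B}, IsInvertibleRightIdeal X.O I → I ≤ X.O →
      ∃ β : (X.B)ˣ, (β : X.B) ∈ X.O ∧ 0 < reducedNorm ℚ X.B β ∧ I = β • X.O) :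
    ∃ g : GL (Fin 2) ℝ, 0 < g.det.val ∧ ∀ m : Matrix (Fin 2) (Fin 2) ℝ, (∃ x ∈ X₁.O, X₁.ι x = m) ↔
      ∃ x ∈ X₂.O, X₂.ι x = (g : Matrix (Fin 2) (Fin 2) ℝ) * m * ((g⁻¹ : GL (Fin 2) ℝ) : Matrix (Fin 2) (Fin 2) ℝ) := by
  have hD0 : D ≠ 0 := fun h => by simpa [h] using X₁.squarefree
  rcases (Nat.one_le_iff_ne_zero.mpr hD0).eq_or_lt with h1 | h1
  · subst h1
    exact exists_gl_pos_conj_of_discr_one X₁ X₂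
  -- `D > 1`
  obtain ⟨ψ⟩ : Nonempty (X₁.B ≃ₐ[ℚ] X₂.B) :=
    nonempty_algEquiv_of_ramifiedPlaces_eq_holds ℚ X₁.B X₂.B (by rw [X₁.ramifiedPlaces_eq, X₂.ramifiedPlaces_eq])
      (by rw [ramifiedInfinitePlaces_eq_empty_of_algHom_real X₁.ι, ramifiedInfinitePlaces_eq_empty_of_algHom_real X₂.ι])
  have hO' : Brandt.IsEichlerOrder X₂.B
      (X₁.O.map ((ψ : X₁.B ≃+* X₂.B).toAddEquiv.toIntLinearEquiv : X₁.B →ₗ[ℤ] X₂.B)) M :=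
    X₁.isEichlerOrder.map_ringEquiv (ψ : X₁.B ≃+* X₂.B)
  obtain ⟨β, hβ⟩ := exists_units_conj_eq_of_isEichlerOrder X₂ h1 (hE h1 X₂) hO'
  obtain ⟨g₀, hg₀⟩ := exists_gl_conj_of_algHom_real X₁.ι (X₂.ι.comp (ψ : X₁.B →ₐ[ℚ] X₂.B))
  set b : GL (Fin 2) ℝ := Units.map (X₂.ι : X₂.B →* Matrix (Fin 2) (Fin 2) ℝ) β with hb_def
  have hb : X₂.ι (β : X₂.B) = (b : Matrix (Fin 2) (Fin 2) ℝ) := rfl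
  have hb' : X₂.ι ((β⁻¹ : (X₂.B)ˣ) : X₂.B) = ((b⁻¹ : GL (Fin 2) ℝ) : Matrix (Fin 2) (Fin 2) ℝ) := by
    rw [hb_def, ← map_inv, Units.coe_map, MonoidHom.coe_coe]
  have hmemO' : ∀ z : X₂.B, z ∈ X₁.O.map ((ψ : X₁.B ≃+* X₂.B).toAddEquiv.toIntLinearEquiv : X₁.B →ₗ[ℤ] X₂.B) ↔
      ((β⁻¹ : (X₂.B)ˣ) : X₂.B) * z * β ∈ X₂.O := by
    intro z
    rw [hβ, mem_units_smul_submodule_iff, mem_op_units_smul_submodule_iff, inv_inv, Units.smul_def, smul_eq_mul]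
  have hψ : ∀ x : X₁.B, (ψ : X₁.B →ₐ[ℚ] X₂.B) x = (ψ : X₁.B ≃+* X₂.B) x := fun _ => rfl
  -- the relation for `g = b⁻¹ g₀`
  have hrel : ∀ m : Matrix (Fin 2) (Fin 2) ℝ, (∃ x ∈ X₁.O, X₁.ι x = m) ↔
      ∃ y ∈ X₂.O, X₂.ι y = ((b⁻¹ * g₀ : GL (Fin 2) ℝ) : Matrix (Fin 2) (Fin 2) ℝ) * m *
        (((b⁻¹ * g₀)⁻¹ : GL (Fin 2) ℝ) : Matrix (Fin 2) (Fin 2) ℝ) := by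
    intro m
    rw [mul_inv_rev, inv_inv, Units.val_mul, Units.val_mul]
    constructor
    · rintro ⟨x, hx, rfl⟩
      refine ⟨((β⁻¹ : (X₂.B)ˣ) : X₂.B) * (ψ : X₁.B ≃+* X₂.B) x * β,
        (hmemO' _).mp ((apply_mem_map_ringEquiv_iff (ψ : X₁.B ≃+* X₂.B)).mpr hx), ?_⟩
      have h := hg₀ x
      rw [AlgHom.comp_apply, hψ] at h
      rw [map_mul, map_mul, h, hb, hb']
      simp only [mul_assoc]
    · rintro ⟨y, hy, hyeq⟩
      have hz : (β : X₂.B) * y * ((β⁻¹ : (X₂.B)ˣ) : X₂.B) ∈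
          X₁.O.map ((ψ : X₁.B ≃+* X₂.B).toAddEquiv.toIntLinearEquiv : X₁.B →ₗ[ℤ] X₂.B) := by
        rw [hmemO']
        simpa only [← mul_assoc, Units.inv_mul, one_mul, Units.inv_mul_cancel_right] using hy
      rw [mem_map_ringEquiv_iff] at hz
      refine ⟨(ψ : X₁.B ≃+* X₂.B).symm ((β : X₂.B) * y * ((β⁻¹ : (X₂.B)ˣ) : X₂.B)), hz, ?_⟩
      have h := hg₀ ((ψ : X₁.B ≃+* X₂.B).symm ((β : X₂.B) * y * ((β⁻¹ : (X₂.B)ˣ) : X₂.B)))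
      rw [AlgHom.comp_apply, hψ, RingEquiv.apply_symm_apply, map_mul, map_mul, hyeq, hb, hb'] at h
      rw [(gl_conj_eq_iff g₀ _ _).mp h.symm]
      simp only [← mul_assoc, Units.mul_inv, one_mul, Units.inv_mul, Units.inv_mul_cancel_right,
        Units.mul_inv_cancel_right]
  -- sign of `det`
  rcases lt_or_gt_of_ne (b⁻¹ * g₀).det.ne_zero with hneg | hpos
  · obtain ⟨u, hu, hu', hnu⟩ := exists_units_reducedNorm_eq_neg_one X₁ h1 (hE h1 X₁)
    have hU := conjRel_units X₁.isOrder.mul_mem X₁.ι u hu hu'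
    refine ⟨b⁻¹ * g₀ * Units.map (X₁.ι : X₁.B →* Matrix (Fin 2) (Fin 2) ℝ) u, ?_, conjRel_trans hU hrel⟩
    have hdetU : (Matrix.GeneralLinearGroup.det (Units.map (X₁.ι : X₁.B →* Matrix (Fin 2) (Fin 2) ℝ) u)).val = -1 := by
      rw [Matrix.GeneralLinearGroup.val_det_apply, Units.coe_map, MonoidHom.coe_coe, AlgHom.det_eq_reducedNorm,
        hnu, map_neg, map_one]
    rw [map_mul, Units.val_mul, hdetU]
    linarith
  · exact ⟨b⁻¹ * g₀, hpos, hrel⟩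


/-! ## §6 Assembly: presentation-independence of the class-minimal degree at level `(D, M; ∅)` -/

section Assembly

open WeierstrassCurve

/-- The Eichler datum under a Cartan datum with NO Cartan place (`O = O₀`; the fundamental domain is the datum's own). [folklore] -/
theorem isHypFundamentalDomain_fd_O₀ {D M : ℕ} (X : CartanLevelCurveData D M ∅) :
    IsHypFundamentalDomain (normOneUnits X.ι X.isEichlerOrder.isOrder) X.fd := by
  have hO : X.O = X.O₀ := le_antisymm X.le fun x hx => by simpa using X.smul_mem x hx
  have key : ∀ (O : Submodule ℤ X.B) (hO' : Brandt.IsOrder X.B O), O = X.O →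
      IsHypFundamentalDomain (normOneUnits X.ι hO') X.fd := by
    rintro O hO' rfl
    exact X.isFundamentalDomain_fd
  exact key X.O₀ X.isEichlerOrder.isOrder hO.symm

/-- **(F2⁰) from Eichler's principal-ideal theorem.** Presentation-independence of the class-minimal degree at level
`(D, M; ∅)` (`CartanDegree.CartanEmptyDegreeIndep`), assuming only the statement `hE` of the TREE THEOREM
`ShimuraCurveData.exists_eq_units_smul_of_pos` (Eichler: invertible integral right ideals of the Eichler order of `X₀^D(M)`,
`D > 1`, are principal with a generator of positive norm; Vignéras III §5 Cor. 5.7) — taken as a hypothesis here only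
because that module's olean is not built on the hub at the time of writing; the unconditional corollary is the one-line
specialisation `cartanEmptyDegreeIndep_of_eichler (fun X hD hM _ hI hIO => X.exists_eq_units_smul_of_pos hD hM hI hIO)`.
PROOF: the two Eichler presentations `(Bᵢ, Oᵢ, ιᵢ)` under `X₁, X₂` are `GL₂⁺(ℝ)`-conjugate (`exists_gl_pos_conj`:
Hasse–Brauer–Noether, type number one, Skolem–Noether, a unit of norm `-1`), and Cartan parametrisation data transport
along `τ ↦ g τ` with the same degree in both directions (`exists_cartanParametrizationData_deg_eq`); class-minimality on
each side gives `Q₁.deg ≤ Q₂.deg ≤ Q₁.deg`. [cite: VignerasLNM800, Ch. III §5 Cor. 5.7, §3 Thm. 3.1, Ch. I §2 Thm. 2.1] -/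
theorem cartanEmptyDegreeIndep_of_eichler
    (hE : ∀ {D M : ℕ} (X : ShimuraCurveData D M), 1 < D → 0 < M → ∀ {I : Submodule ℤ X.B},
      IsInvertibleRightIdeal X.O I → I ≤ X.O →
        ∃ β : (X.B)ˣ, (β : X.B) ∈ X.O ∧ 0 < reducedNorm ℚ X.B β ∧ I = β • X.O) :
    CartanEmptyDegreeIndep := by
  intro V _ D M X₁ W₁ _ Q₁ X₂ W₂ _ Q₂ h₁ h₂
  have hO₁ : X₁.O = X₁.O₀ := le_antisymm X₁.le fun x hx => by simpa using X₁.smul_mem x hx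
  have hO₂ : X₂.O = X₂.O₀ := le_antisymm X₂.le fun x hx => by simpa using X₂.smul_mem x hx
  set XS₁ : ShimuraCurveData D M := X₁.toShimuraCurveData X₁.fd (isHypFundamentalDomain_fd_O₀ X₁) with hXS₁
  set XS₂ : ShimuraCurveData D M := X₂.toShimuraCurveData X₂.fd (isHypFundamentalDomain_fd_O₀ X₂) with hXS₂
  have hM : 0 < M := by
    haveI : IsAddTorsionFree X₁.B := isAddTorsionFree_of_charZero_module ℚ X₁.B
    obtain ⟨O₁, O₂, h₁, -, -, hidx⟩ := X₁.isEichlerOrder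
    refine Nat.pos_of_ne_zero ?_
    rw [← hidx]
    exact relIndex_ne_zero_of_isFullLattice X₁.isEichlerOrder.isOrder.isFullLattice h₁.1.isFullLattice.1
  obtain ⟨g, hg, Hg⟩ := exists_gl_pos_conj XS₁ XS₂ fun hD X _ hI hIO => hE X hD hM hI hIO
  have H : ∀ m : Matrix (Fin 2) (Fin 2) ℝ, (∃ x ∈ X₁.O, X₁.ι x = m) ↔
      ∃ x ∈ X₂.O, X₂.ι x = (g : Matrix (Fin 2) (Fin 2) ℝ) * m * ((g⁻¹ : GL (Fin 2) ℝ) : Matrix (Fin 2) (Fin 2) ℝ) := by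
    intro m
    rw [hO₁, hO₂]
    exact Hg m
  have hg' : 0 < (g⁻¹).det.val := by
    rw [map_inv, Units.val_inv_eq_inv_val]
    exact inv_pos.mpr hg
  obtain ⟨Q₂', h₂'⟩ := exists_cartanParametrizationData_deg_eq X₁ X₂ H hg Q₂
  obtain ⟨Q₁', h₁'⟩ := exists_cartanParametrizationData_deg_eq X₂ X₁ (conjRel_symm H) hg' Q₁
  refine le_antisymm ?_ ?_
  · rw [← h₂']
    exact h₁.2 W₂ Q₂' h₂.1
  · rw [← h₁']
    exact h₂.2 W₁ Q₁' h₁.1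

end Assembly

end Summit.BirchSwinnertonDyer.BirchSwinnertonDyer.Theorems.CartanDegree

end
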